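import Mathlib
import Summits.NavierStokesRegularity.NavierStokesRegularity.Theorems.FilamentSkeletonRssClause13RRateColumnBall

/-!
# Clause 13 dictionary (c1), first brick: the matched kernel along a NEAR-STRAIGHT filament vs the straight model kernel —
# `(1 − R_b)|τ−σ| ≤ ‖X τ − X σ‖ ≤ |τ−σ|` and `0 ≤ ((‖X τ − X σ‖² + q)^{3/2})⁻¹ − (((τ−σ)² + q)^{3/2})⁻¹ ≤ 20R_b·(((τ−σ)² + q)^{3/2})⁻¹`

Route `FilamentSkeletonRss`, crux `Clause13RNearStraightL` (stmt-NavierStokesRegularity-23612), line `rate_bordered_split` (both stubs).  Step (c1) of the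
clause dictionary (memo `CENSUS-23610-side-23612-g16.md` §3; item 1 of `DIAG-23612-rate-row-leafhand3-g0.md` §4) compares the self term of the closed form of
`DT·Y` (`…Clause13LinearisedMapClauses`) along the actual near-straight filament with the straight constant-core model (B1 `selfIntegrand_straight`).  Its
`Y`-independent part is the comparison of the Rosenhead kernels `K₃(‖Δ‖² + q)` (`Δ = X τ − X σ`) and `K₃((τ−σ)² + q)`; on the doubled tangency ball the core
`q = κ·Aa_j(c_j)` IS constant (clause 13, rigid cores), so only the chord enters.  Near-straightness (tolerance `‖X′τ − X′σ‖ ≤ R_b`, unit speed) pins the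
chord between `(1 − R_b)|τ−σ|` and `|τ−σ|`, whence the kernel comparison with the explicit constant `20R_b` for `R_b ≤ 1/2`
(`(1 − x)⁻³ ≤ 1 + 20x` on `[0, 1/2]`).

* `norm_chord_le`, `norm_chord_ge` — the two chord bounds;
* `one_sub_pow_three_inv_le` — `((1 − x)^3)⁻¹ ≤ 1 + 20x` for `0 ≤ x ≤ 1/2`;
* `kernel_chord_ge_model`, `kernel_chord_sub_model_le` — **`0 ≤ K₃(‖Δ‖²+q) − K₃((τ−σ)²+q) ≤ 20R_b·K₃((τ−σ)²+q)`**.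

Hand `leafhand-ns-filamentskeletonrs-3-g0` (LAND-ONLY); `--supports stmt-NavierStokesRegularity-23612 --as helper`.  HONEST FRAMING: elementary estimates for a
HYPOTHETICAL near-straight filament skeleton on the NEGATIVE side of a MODEL blow-up route; nothing here bears on Navier–Stokes regularity or blow-up; neither
stub is proved here (the `Y`-dependent remainders of (c1) and the curvature slaving on the ball are NOT here).
-/

noncomputable section

open Real
open Summit.NavierStokesRegularity.NavierStokesRegularity.Theorems.Clause13RRateRow (norm_sub_waist_le norm_sub_chord_le)

namespace Summit.NavierStokesRegularity.NavierStokesRegularity.Theorems.Clause13NearStraightKernel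
set_option linter.dupNamespace false

/-- Upper chord bound (unit speed): `‖X τ − X σ‖ ≤ |τ − σ|`. [folklore] -/
theorem norm_chord_le {X : ℝ → EuclideanSpace ℝ (Fin 3)} (hX : Differentiable ℝ X) (hunit : ∀ σ, ‖deriv X σ‖ = 1) (τ σ : ℝ) :
    ‖X τ - X σ‖ ≤ |τ - σ| := norm_sub_waist_le hX hunit σ τ

/-- Lower chord bound (near-straightness): `(1 − R_b)|τ − σ| ≤ ‖X τ − X σ‖`. [folklore] -/
theorem norm_chord_ge {X : ℝ → EuclideanSpace ℝ (Fin 3)} {Rb : ℝ} (hX : Differentiable ℝ X) (hunit : ∀ σ, ‖deriv X σ‖ = 1)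
    (hns : ∀ τ σ, ‖deriv X τ - deriv X σ‖ ≤ Rb) (τ σ : ℝ) : (1 - Rb) * |τ - σ| ≤ ‖X τ - X σ‖ := by
  have h := norm_sub_chord_le hX hns σ τ
  -- ‖(τ−σ)•X′σ‖ = |τ−σ| and ‖X τ − X σ‖ ≥ ‖(τ−σ)•X′σ‖ − ‖X τ − X σ − (τ−σ)•X′σ‖
  have hn : ‖(τ - σ) • deriv X σ‖ = |τ - σ| := by rw [norm_smul, Real.norm_eq_abs, hunit σ, mul_one]
  have htri : ‖(τ - σ) • deriv X σ‖ - ‖X τ - X σ‖ ≤ ‖X τ - X σ - (τ - σ) • deriv X σ‖ := by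
    have := norm_sub_norm_le ((τ - σ) • deriv X σ) (X τ - X σ)
    rwa [norm_sub_rev ((τ - σ) • deriv X σ) (X τ - X σ)] at this
  rw [hn] at htri
  nlinarith [abs_nonneg (τ - σ)]

/-- `((1 − x)^3)⁻¹ ≤ 1 + 20x` for `0 ≤ x ≤ 1/2` (i.e. `1 ≤ (1 + 20x)(1 − x)^3` there). [folklore] -/
theorem one_sub_pow_three_inv_le {x : ℝ} (h0 : 0 ≤ x) (h1 : x ≤ 1 / 2) : ((1 - x) ^ 3)⁻¹ ≤ 1 + 20 * x := by
  have hpos : 0 < (1 - x) ^ 3 := pow_pos (by linarith) 3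
  rw [inv_le_iff_one_le_mul₀ hpos]
  -- (1 + 20x)(1 − x)^3 − 1 = x·[(17 − 57x + 49x²) + 10x²(1 − 2x)]
  have hq : 0 ≤ 17 - 57 * x + 49 * x ^ 2 := by nlinarith [sq_nonneg (x - 57 / 98)]
  have hc : 0 ≤ 10 * x ^ 2 * (1 - 2 * x) := mul_nonneg (by positivity) (by linarith)
  nlinarith [mul_nonneg h0 hq, mul_nonneg h0 hc]

/-- **Kernel comparison, lower side**: the actual kernel dominates the model kernel, `K₃((τ−σ)²+q) ≤ K₃(‖X τ − X σ‖²+q)` (the chord is shorter than the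
arc). [folklore] -/
theorem kernel_chord_ge_model {X : ℝ → EuclideanSpace ℝ (Fin 3)} {q : ℝ} (hX : Differentiable ℝ X) (hunit : ∀ σ, ‖deriv X σ‖ = 1) (hq : 0 < q)
    (τ σ : ℝ) : (((τ - σ) ^ 2 + q) ^ (3 / 2 : ℝ))⁻¹ ≤ ((‖X τ - X σ‖ ^ 2 + q) ^ (3 / 2 : ℝ))⁻¹ := by
  have hc := norm_chord_le hX hunit τ σ
  have h1 : ‖X τ - X σ‖ ^ 2 ≤ (τ - σ) ^ 2 := by
    rw [← sq_abs (τ - σ)]; exact pow_le_pow_left₀ (norm_nonneg _) hc 2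
  have hA : 0 < ‖X τ - X σ‖ ^ 2 + q := by positivity
  apply inv_anti₀ (Real.rpow_pos_of_pos hA _)
  exact Real.rpow_le_rpow hA.le (by linarith) (by norm_num)

/-- **KERNEL COMPARISON ALONG A NEAR-STRAIGHT FILAMENT**: for `R_b ≤ 1/2`,
`K₃(‖X τ − X σ‖² + q) − K₃((τ−σ)² + q) ≤ 20R_b · K₃((τ−σ)² + q)`. [folklore] -/
theorem kernel_chord_sub_model_le {X : ℝ → EuclideanSpace ℝ (Fin 3)} {Rb q : ℝ} (hX : Differentiable ℝ X) (hunit : ∀ σ, ‖deriv X σ‖ = 1)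
    (hns : ∀ τ σ, ‖deriv X τ - deriv X σ‖ ≤ Rb) (hRb : Rb ≤ 1 / 2) (hq : 0 < q) (τ σ : ℝ) :
    ((‖X τ - X σ‖ ^ 2 + q) ^ (3 / 2 : ℝ))⁻¹ - (((τ - σ) ^ 2 + q) ^ (3 / 2 : ℝ))⁻¹
      ≤ 20 * Rb * (((τ - σ) ^ 2 + q) ^ (3 / 2 : ℝ))⁻¹ := by
  have hRb0 : 0 ≤ Rb := le_trans (norm_nonneg _) (hns σ σ)
  have h1Rb : 0 < 1 - Rb := by linarith
  set A := ‖X τ - X σ‖ ^ 2 + q with hA_def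
  set B := (τ - σ) ^ 2 + q with hB_def
  have hA : 0 < A := by positivity
  have hB : 0 < B := by positivity
  -- (1 − R_b)²·B ≤ A
  have hlow : (1 - Rb) ^ 2 * B ≤ A := by
    have hc := norm_chord_ge hX hunit hns τ σ
    have hc2 : ((1 - Rb) * |τ - σ|) ^ 2 ≤ ‖X τ - X σ‖ ^ 2 :=
      pow_le_pow_left₀ (mul_nonneg h1Rb.le (abs_nonneg _)) hc 2
    rw [mul_pow, sq_abs] at hc2
    have hq' : (1 - Rb) ^ 2 * q ≤ q := by
      have h1 : (1 - Rb) ^ 2 ≤ 1 := by nlinarith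
      exact mul_le_of_le_one_left hq.le h1
    rw [hA_def, hB_def, mul_add]
    linarith
  -- hence A^{-3/2} ≤ ((1−R_b)² B)^{-3/2} = (1−R_b)⁻³ B^{-3/2}
  have hpowle : (A ^ (3 / 2 : ℝ))⁻¹ ≤ (((1 - Rb) ^ 2 * B) ^ (3 / 2 : ℝ))⁻¹ := by
    have hpos : 0 < (1 - Rb) ^ 2 * B := mul_pos (pow_pos h1Rb 2) hB
    apply inv_anti₀ (Real.rpow_pos_of_pos hpos _)
    exact Real.rpow_le_rpow hpos.le hlow (by norm_num)
  have hsplit : (((1 - Rb) ^ 2 * B) ^ (3 / 2 : ℝ))⁻¹ = ((1 - Rb) ^ 3)⁻¹ * (B ^ (3 / 2 : ℝ))⁻¹ := by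
    rw [Real.mul_rpow (pow_nonneg h1Rb.le 2) hB.le, mul_inv]
    congr 1
    rw [← Real.rpow_natCast (1 - Rb) 2, ← Real.rpow_mul h1Rb.le, ← Real.rpow_natCast (1 - Rb) 3]
    norm_num
  have hcoef : ((1 - Rb) ^ 3)⁻¹ ≤ 1 + 20 * Rb := one_sub_pow_three_inv_le hRb0 hRb
  have hBnn : 0 ≤ (B ^ (3 / 2 : ℝ))⁻¹ := inv_nonneg.2 (Real.rpow_nonneg hB.le _)
  calc (A ^ (3 / 2 : ℝ))⁻¹ - (B ^ (3 / 2 : ℝ))⁻¹ ≤ ((1 - Rb) ^ 3)⁻¹ * (B ^ (3 / 2 : ℝ))⁻¹ - (B ^ (3 / 2 : ℝ))⁻¹ := by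
        rw [← hsplit]; linarith
    _ ≤ (1 + 20 * Rb) * (B ^ (3 / 2 : ℝ))⁻¹ - (B ^ (3 / 2 : ℝ))⁻¹ := by
        have := mul_le_mul_of_nonneg_right hcoef hBnn; linarith
    _ = 20 * Rb * (B ^ (3 / 2 : ℝ))⁻¹ := by ring

end Summit.NavierStokesRegularity.NavierStokesRegularity.Theorems.Clause13NearStraightKernel

end
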